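import Mathlib
import Summits.QuantumFields.BalabanUV.Beta.AnalyticWalkSum216RowResolvent

/-!
# [Balaban1985BackgroundPropagators] (3.138) p. 423 «G₁ = G₀(I − (Δ′_π + Δ^{(2)}_π)G₀)⁻¹ = Σ_{n=0}^∞ G₀((Δ′_π + Δ^{(2)}_π)G₀)ⁿ»
# and p. 432 «we can investigate the operator G₂ perturbatively in the same way as the operator G₁ in (3.138)» — THE
# PERTURBATIVE NEUMANN LAYER G₂ = G̃₀(1 + Δ″G̃₀)⁻¹ IN THE VOLUME-FREE ROW-DATA CURRENCY: row data of the decorated G̃₀-family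
# (ρ₀) + row data of the ONE-FACTOR family «Δ″G̃₀» (θ < 1) ⟹ row data ρ₀(1 − θ)⁻¹ of the G₂-family, summing to
# G̃₀(1 + XG̃₀)⁻¹ = (G̃₀⁻¹ + X)⁻¹ (cell topic `Summits/QuantumFields/BalabanUV/Beta`; row-D4 NODE A.4, leaves A.4.3∕A.4.6 in
# abstract form; sibling of `AnalyticWalkSum216RowResolvent(Omega∕Proj)`)

HONEST FRAMING (cell rule).  Discharging `BetaPertH` makes Bałaban's UV stability UNCONDITIONAL — a real constructive-QFT
result; NOT the continuum limit, NOT the Clay problem.  This module discharges NOTHING of `BetaPertH`.  [folklore]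
bookkeeping: the first link of the abstract chain G̃₀ →(Neumann, this file)→ G₂ →((3.186), constrained)→ G̃₂
→(Woodbury on the constrained covariance, siblings)→ G̃₃(x) of the row-D4 apex outline NODE A.4∕A.3
(`HOME/b2b-balaban-beta-an4/g38/OUTLINE-D4-NODE-A.md` v1.4 §2 leaves A.4.3 «the Neumann series on the G-B9-16 template» and
A.4.6 «walk bookkeeping», census `BETA/REMAINDER-BETA.md` §10).  WHAT IT MAKES PRECISE: in the (2.16) currency (entrywise
kernel bounds with exponential weights, NO scale weights and NO ∇-entries) the whole content of [13]'s «perturbatively in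
the same way as (3.138)» is the pair of hypotheses `hG₀` (row data of G̃₀'s decorated expansion = leaf A.4.0, Thms 3.3∕3.10
for the tilde sequence) and `hW` (row data with constant `θ < 1` of the ONE-FACTOR family of Δ″G̃₀ — leaf A.4.2 ⊕ its
decoration; this is where print's multi-norm induction G-B9-16∕G-pv21g2-1 and the owner's NOTE-A42 sit: the supplier of
`hW` must produce `θ = O(1)Mα₀` for the decorated products X·G̃₀-term, first factors under ∇ by the Hölder routing of
p. 423), plus the identification `termSum TW = X·termSum TG₀`; everything after them is `RowData.prod` ∘ `rowData_neumann`
BY NAME.  Nothing of Bałaban's operators is instantiated ((T3) and NODE O.2 untouched); NO class change on any GAPS row;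
readiness width 0 unchanged; NOT summit progress.  Unit `b2b-balaban-beta-an4-g38` (owner of `BINDER-OWNERS.md` row D4);
`GAPS.md` C-an4-95.

CITATION HEADER (lean-in-tree rule).  [13] = T. Bałaban, *Propagators for lattice gauge theories in a background field*,
Commun. Math. Phys. **99**, 389–434 (1985) [Balaban1985BackgroundPropagators], p. 423 [PDF 35] (render
`HOME/b2b-balaban-ref1/pages/1985-cmp99-background-propagators/…-p035-x2.png`, READ AS IMAGE by this seat 2026-08-20),
verbatim: *"Similarly as in (3.130) we get G₁ = G₀(I − (Δ′_π + Δ^{(2)}_π)G₀)⁻¹ = Σ_{n=0}^∞ G₀((Δ′_π + Δ^{(2)}_π)G₀)ⁿ. (3.138)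
Estimates of the terms in this series are now a little bit more complicated. It is connected with the fact that we have
derivatives in the operator Δ′_π + Δ^{(2)}_π which have to be applied either to the operator on the right, or on the
left … This estimate is given for first factors in a term, the remaining factors are easier to estimate, following the
above pattern. … the series (3.138) is convergent for α₀ restricted by a small, absolute constant."*; p. 432 [PDF 44]
(render `…-p044-x2.png`, READ AS IMAGE today): *"Thus we can investigate the operator G₂ perturbatively in the same way as
the operator G₁ in (3.138). The analysis is even simpler because the new terms are more regular, as it follows easily
from (3.184)."*  Nothing printed is asserted; the displays LOCATE the operation (print's sign convention G₀⁻¹ − Δ′ vs. the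
cell's G̃₀⁻¹ + Δ″ is immaterial: `X` below is any matrix family).

WHAT IS CERTIFIED HERE (kernel, sorry-free; [folklore]).
§1 `negTerm`∕`rowData_neg`∕`termSum_neg` (the family `−T`, same constant); the PERTURBED FAMILY `pertTerm TG₀ TW :=
   prodTerm TG₀ (neuTerm (−TW))` and its majorant.
§2 **`rowData_pert`**: `RowData TG₀ ρ₀` + `RowData TW θ` + `θ < 1` ⟹ `RowData (pertTerm TG₀ TW) (ρ₀(1 − θ)⁻¹)` — x-free,
   VOLUME-FREE (`rowData_neumann` + `prod` BY NAME); END **`wrs_pert_sub`** (the (2.16)-shape).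
§3 **`termSum_pert`**: `termSum (pertTerm TG₀ TW) σ = G̃₀(σ)·(1 + W(σ))⁻¹`; **`termSum_pert_eq_inv`**: with `W(σ) = X·G̃₀(σ)` and
   `G̃₀(σ)` invertible, `= (G̃₀(σ)⁻¹ + X)⁻¹` — the G₂ = (G̃₀⁻¹ + Δ″)⁻¹ shape (C-adv8-2's decomposition).
§4 Non-vacuity.
NOT CLAIMED.  Any bound on Bałaban's Δ″G̃₀ (hypothesis `hW`), any expansion of G̃₀ (hypothesis `hG₀`); the (3.186) layer and
the x-tilt (siblings); positivity A.4.4; k-uniformity (NODE O.2).  NOT summit progress.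
PRIOR ART IN THE TREE (searched 2026-08-20): `AnalyticWalkSum216RowNeumann` (gen 37: `rowData_neumann`, `termSum_neumann'` —
USED BY NAME), `AnalyticWalkSum216RowData` (`prod`, `smul`, `termSum_prod'`), `DecayingKernelNeumann(Unique)` (gen 36: the
same Neumann mechanism in the decay currency without term structure), pv21-g2 `B6RandomWalkHom.b9_sectD_nthTerm` (the
block-majorant n-th-term bound with scale weights — the currency in which `hW` is PRODUCED; complementary).
-/

namespace Summit.QuantumFields.BalabanUV.Beta.AnalyticWalkSum216RowPerturbation

open Metric Set
open Literature.MathematicalPhysics.QuantumFieldTheory.Balaban1983to89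
open B13PerturbativeStep (WRS WeightHyp wrs)
open Summit.QuantumFields.BalabanUV.Beta.AnalyticWalkSum216 (termSum majSum)
open Summit.QuantumFields.BalabanUV.Beta.AnalyticWalkSum216Algebra (prodTerm prodMaj termSum_smul)
open Summit.QuantumFields.BalabanUV.Beta.AnalyticWalkSum216Neumann (neuTerm neuMaj)
open Summit.QuantumFields.BalabanUV.Beta.AnalyticWalkSum216RowData (RowData termSum_prod')
open Summit.QuantumFields.BalabanUV.Beta.AnalyticWalkSum216RowNeumann (rowData_neumann termSum_neumann')

noncomputable section

variable {Y : Type*} [Fintype Y] [DecidableEq Y] {W V : Type*} {κ : ℝ} {d : Y → Y → ℝ} {R : ℝ}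

/-! ## §1 The negated family and the perturbed family -/

/-- The NEGATED family `−T` (for `(1 + W)⁻¹ = Σ (−W)ⁿ`). [folklore] -/
def negTerm (T : V → ℂ → Matrix Y Y ℂ) : V → ℂ → Matrix Y Y ℂ := fun v σ => (-1 : ℂ) • T v σ

/-- Its majorant (unchanged up to the factor `1`). [folklore] -/
def negMaj (m : V → Y → Y → ℝ) : V → Y → Y → ℝ := fun v i j => 1 * m v i j

omit [DecidableEq Y] in
/-- Row data of the negated family, same constant (`RowData.smul` with `‖−1‖ ≤ 1`). [folklore] -/
theorem rowData_neg {T : V → ℂ → Matrix Y Y ℂ} {m : V → Y → Y → ℝ} {θ : ℝ} (h : RowData κ d R T m θ) :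
    RowData κ d R (negTerm T) (negMaj m) (1 * θ) :=
  h.smul (c := (-1 : ℂ)) (X := 1) (by rw [norm_neg, norm_one])

omit [Fintype Y] [DecidableEq Y] in
/-- `termSum (negTerm T) σ = −termSum T σ`. [folklore] -/
theorem termSum_neg (T : V → ℂ → Matrix Y Y ℂ) (σ : ℂ) : termSum (negTerm T) σ = -termSum T σ := by
  rw [← neg_one_smul ℂ (termSum T σ), ← termSum_smul T (-1 : ℂ) σ]
  rfl

/-- THE PERTURBED FAMILY `G̃₀·Σ_n(−W)ⁿ` as ONE walk-term family: products of a G̃₀-term with an ordered product of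
(negated) one-factor terms ([13] (3.138): «Replacing the operators in (3.138) by their random walk expansions we get a
random walk expansion for G₁»). [cite: Balaban1985BackgroundPropagators, (3.138) p.423] -/
def pertTerm (TG₀ : W → ℂ → Matrix Y Y ℂ) (TW : V → ℂ → Matrix Y Y ℂ) :
    W × (Σ k, Fin k → V) → ℂ → Matrix Y Y ℂ :=
  prodTerm TG₀ (neuTerm (negTerm TW))

/-- Its majorant. [folklore] -/
def pertMaj (mG₀ : W → Y → Y → ℝ) (mW : V → Y → Y → ℝ) : W × (Σ k, Fin k → V) → Y → Y → ℝ :=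
  prodMaj mG₀ (neuMaj (negMaj mW))

/-! ## §2 Row data of the perturbed family: constant `ρ₀(1 − θ)⁻¹`, volume-free -/

section Pert

variable {TG₀ : W → ℂ → Matrix Y Y ℂ} {mG₀ : W → Y → Y → ℝ} {ρ₀ : ℝ}
  {TW : V → ℂ → Matrix Y Y ℂ} {mW : V → Y → Y → ℝ} {θ : ℝ}

/-- **THE NEUMANN LAYER, VOLUME-FREE**: row data of the decorated G̃₀-family (constant `ρ₀`) and of the ONE-FACTOR family
`W = Δ″G̃₀` (constant `θ < 1`) ⟹ row data of the perturbed family with constant `ρ₀·(1 − θ)⁻¹` (`rowData_neumann` on `−W`,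
then `RowData.prod` BY NAME). [cite: Balaban1985BackgroundPropagators, (3.138) p.423] -/
theorem rowData_pert [Nonempty Y] (hG₀ : RowData κ d R TG₀ mG₀ ρ₀) (hW : RowData κ d R TW mW θ) (hw : WeightHyp κ d)
    (hR : 0 < R) (hθ : θ < 1) : RowData κ d R (pertTerm TG₀ TW) (pertMaj mG₀ mW) (ρ₀ * (1 - θ)⁻¹) := by
  have hN := rowData_neumann (rowData_neg hW) hw hR (by rwa [one_mul])
  rw [one_mul] at hN
  exact hG₀.prod hN hw hR

/-- **END (2.16)-shape for the perturbed family**: `WRS κ d (T(σ) − T(0)) (2ρ₀(1 − θ)⁻¹/R·‖σ‖)`.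
[cite: Balaban1988RG2Cluster, (2.16)–(2.17) p.16] -/
theorem wrs_pert_sub [Nonempty Y] (hG₀ : RowData κ d R TG₀ mG₀ ρ₀) (hW : RowData κ d R TW mW θ) (hw : WeightHyp κ d)
    (hR : 0 < R) (hθ : θ < 1) {σ : ℂ} (hσ : σ ∈ ball (0 : ℂ) R) :
    WRS κ d (termSum (pertTerm TG₀ TW) σ - termSum (pertTerm TG₀ TW) 0) (2 * (ρ₀ * (1 - θ)⁻¹) / R * ‖σ‖) :=
  (rowData_pert hG₀ hW hw hR hθ).wrs_termSum_sub hR hσ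

/-! ## §3 The sum: `G̃₀(1 + W)⁻¹`, and `(G̃₀⁻¹ + X)⁻¹` when `W = X·G̃₀` -/

/-- **`termSum (pertTerm TG₀ TW) σ = G̃₀(σ)·(1 + W(σ))⁻¹`** on the disc (`termSum_prod'` + `termSum_neumann'` + `termSum_neg`).
[cite: Balaban1985BackgroundPropagators, (3.138) p.423] -/
theorem termSum_pert [Nonempty Y] (hG₀ : RowData κ d R TG₀ mG₀ ρ₀) (hW : RowData κ d R TW mW θ) (hw : WeightHyp κ d)
    (hR : 0 < R) (hθ : θ < 1) {σ : ℂ} (hσ : σ ∈ ball (0 : ℂ) R) :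
    termSum (pertTerm TG₀ TW) σ = termSum TG₀ σ * (1 + termSum TW σ)⁻¹ := by
  have hN' := rowData_neg hW (κ := κ) (d := d) (R := R)
  have hθ' : 1 * θ < 1 := by rwa [one_mul]
  have hN := rowData_neumann hN' hw hR hθ'
  rw [pertTerm, termSum_prod' hG₀ hN hσ, termSum_neumann' hN' hw hR hθ' hσ, termSum_neg, sub_neg_eq_add]

/-- **THE G₂ = (G̃₀⁻¹ + Δ″)⁻¹ SHAPE**: if the one-factor family sums to `X(σ)·G̃₀(σ)` and `G̃₀(σ)` is invertible, the
perturbed family sums to `(G̃₀(σ)⁻¹ + X(σ))⁻¹` (C-adv8-2's decomposition `G₂⁻¹ = G̃₀⁻¹ + Δ″`).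
[cite: Balaban1985BackgroundPropagators, p.432 after (3.186)] -/
theorem termSum_pert_eq_inv [Nonempty Y] (hG₀ : RowData κ d R TG₀ mG₀ ρ₀) (hW : RowData κ d R TW mW θ)
    (hw : WeightHyp κ d) (hR : 0 < R) (hθ : θ < 1) {σ : ℂ} (hσ : σ ∈ ball (0 : ℂ) R) (X : Matrix Y Y ℂ)
    (hWX : termSum TW σ = X * termSum TG₀ σ) (hGu : IsUnit (termSum TG₀ σ)) :
    termSum (pertTerm TG₀ TW) σ = ((termSum TG₀ σ)⁻¹ + X)⁻¹ := by
  have hdet : IsUnit (termSum TG₀ σ).det := (Matrix.isUnit_iff_isUnit_det _).1 hGu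
  rw [termSum_pert hG₀ hW hw hR hθ hσ, hWX]
  have h1 : (termSum TG₀ σ)⁻¹ + X = (1 + X * termSum TG₀ σ) * (termSum TG₀ σ)⁻¹ := by
    rw [Matrix.add_mul, Matrix.one_mul, Matrix.mul_assoc, Matrix.mul_nonsing_inv _ hdet, Matrix.mul_one]
  rw [h1, Matrix.mul_inv_rev, Matrix.nonsing_inv_nonsing_inv _ hdet]

/-- The one-factor smallness also makes `1 + W(σ)` invertible on the disc (`WRS` bound `θ < 1`,
`B13PerturbativeStep.isUnit_one_add` BY NAME). [folklore] -/
theorem isUnit_one_add_termSum (hW : RowData κ d R TW mW θ) (hw : WeightHyp κ d) (hθ : θ < 1) {σ : ℂ}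
    (hσ : σ ∈ ball (0 : ℂ) R) : IsUnit (1 + termSum TW σ) :=
  B13PerturbativeStep.isUnit_one_add hw (hW.wrs_termSum hσ) hθ

end Pert

/-! ## §4 Non-vacuity -/

/-- The hypotheses of `rowData_pert` ∕ `wrs_pert_sub` are jointly satisfiable: one site, G̃₀-family = the one-term family
`T(σ) = σ` (row data with constant `1` on the unit disc, `AnalyticWalkSum216RowData.rowData_example`), one-factor family
= `½·T` (constant `θ = ½ < 1` by `RowData.smul`), at `σ = ½`. [folklore] -/
example : WRS (n := Unit) 0 (fun _ _ => 0)
    (termSum (pertTerm (fun (_ : Unit) (σ : ℂ) => fun (_ _ : Unit) => σ)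
        (fun (_ : Unit) (σ : ℂ) => (1 / 2 : ℂ) • fun (_ _ : Unit) => σ)) (1 / 2) -
      termSum (pertTerm (fun (_ : Unit) (σ : ℂ) => fun (_ _ : Unit) => σ)
        (fun (_ : Unit) (σ : ℂ) => (1 / 2 : ℂ) • fun (_ _ : Unit) => σ)) 0)
    (2 * (1 * (1 - 1 / 2 * 1)⁻¹) / 1 * ‖(1 / 2 : ℂ)‖) := by
  have hw : WeightHyp (n := Unit) 0 (fun _ _ => 0) := ⟨le_rfl, fun _ => rfl, fun _ _ => le_rfl, fun _ _ _ => by simp⟩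
  have h := AnalyticWalkSum216RowData.rowData_example
  have hW := h.smul (c := (1 / 2 : ℂ)) (X := 1 / 2) (by norm_num)
  refine wrs_pert_sub h hW hw one_pos (by norm_num) ?_
  rw [mem_ball_zero_iff]; norm_num

end

end Summit.QuantumFields.BalabanUV.Beta.AnalyticWalkSum216RowPerturbation
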